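import Mathlib
import Literature.NumberTheory.Transcendental.KZCalculusProofs
import Literature.NumberTheory.Transcendental.SemialgebraicMapsProofs

/-!
# `OffTetraSectorKernel` (stmt-KontsevichZagierPeriods-10557), line `odd-hyperbolic-ladder`: the inversion move

Stub `stub_inversionMove` (lead). In the upper half-space model `ℝⁿ × ℝ₊` of hyperbolic `(n+1)`-space
(coordinates `p : Fin (n + 1) → ℝ`, height `t = p (Fin.last n)`) the UNIT INVERSION `J p = p / ‖p‖²` is a
hyperbolic isometry, and for the rational volume density `t^{-(n+1)}` it is ONE Kontsevich–Zagier change of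
variables (rule (2), `KZ.changeOfVariablesRel`) in EVERY dimension: on any `σ ⊆ {t > 0}`

* `J` is a `ℚ`-semialgebraic map (coordinates `pₗ / Σ pₘ²`, denominator `> 0` on `σ`);
* `J` is an involution off the origin, hence injective on `σ`;
* `J` has at `p ≠ 0` the Fréchet derivative `L = ‖p‖⁻² (I − 2 p pᵀ / ‖p‖²)` (a scaled reflection), whose
  determinant is `−‖p‖^{-2(n+1)}` by the matrix determinant lemma, whence the Jacobian identity
  `t^{-(n+1)} = ((J p) last)^{-(n+1)} · |det L|` (`(J p) last = t / ‖p‖²`).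

So every representation `r'` with domain `J '' r.domain` and integrand `t^{-(n+1)}` there is KZ-equivalent to
`r = [σ, t^{-(n+1)}]` by exhibiting the single element `[r] − [r']` of `KZ.changeOfVariablesRel`. This is the
dimension-generic parent of the landed `n = 2` file `HyperbolicBlochIsometryMoveInversion.lean` (where the
determinant was `det_fin_three`); together with the boundary similarities it generates every `ℚ̄`-Möbius
congruence of the half-space (Bruhat decomposition), i.e. the congruence half of Goncharov's scissors ladder.

References: R. Benedetti, C. Petronio, *Lectures on Hyperbolic Geometry* (1992), A.3.5; M. Kontsevich, D. Zagier,
*Periods* (2001), §1.2 rule (2); A. B. Goncharov, *Volumes of hyperbolic manifolds and mixed Tate motives* (1999), §1.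
-/

noncomputable section

open Set MeasureTheory MvPolynomial Matrix
open Literature.NumberTheory.Transcendental Literature.ModelTheory.ExponentialFields

namespace Summit.KontsevichZagierPeriods.HyperbolicBloch.OffTetraSectorKernel

variable {n : ℕ}

/-- On the open upper half-space the squared norm `Σ pₘ²` is positive. [folklore] -/
theorem inversionN_normSq_pos {p : Fin (n + 1) → ℝ} (hp : 0 < p (Fin.last n)) : 0 < ∑ m, p m ^ 2 :=
  lt_of_lt_of_le (pow_pos hp 2)
    (Finset.single_le_sum (f := fun m => p m ^ 2) (fun m _ => sq_nonneg (p m)) (Finset.mem_univ _))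

/-- The coordinates of the unit inversion are quotients of rational polynomials with denominator `Σ pₘ² > 0`
on `σ ⊆ {t > 0}`; hence the inversion is a `ℚ`-semialgebraic map on `σ`. [cite: BochnakCosteRoy1998, §2.2] -/
theorem inversionN_isSemialgebraicMapOn {σ : Set (Fin (n + 1) → ℝ)} (hσ : IsSemialgebraic ℚ σ)
    (hpos : σ ⊆ {p | 0 < p (Fin.last n)}) :
    IsSemialgebraicMapOn ℚ σ (fun p : Fin (n + 1) → ℝ => fun l => p l / ∑ m, p m ^ 2) := by
  set q : MvPolynomial (Fin (n + 1)) ℚ := ∑ m, X m ^ 2 with hq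
  have hqe : ∀ p : Fin (n + 1) → ℝ, aeval p q = ∑ m, p m ^ 2 := fun p => by
    simp [hq, map_sum]
  have hq0 : ∀ p ∈ σ, aeval p q ≠ 0 := fun p hp => by
    rw [hqe]; exact (inversionN_normSq_pos (hpos hp)).ne'
  refine IsSemialgebraicMapOn.of_forall hσ fun l => ?_
  exact (isSemialgebraicFunOn_aeval_div_aeval hσ (X l) q hq0).congr fun p _ => by simp [hqe]

/-- `‖J p‖² = 1 / ‖p‖²` for `p ≠ 0`. [folklore] -/
theorem inversionN_normSq_apply {p : Fin (n + 1) → ℝ} (hp : ∑ m, p m ^ 2 ≠ 0) :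
    ∑ l, (p l / ∑ m, p m ^ 2) ^ 2 = (∑ m, p m ^ 2)⁻¹ := by
  simp_rw [div_pow, ← Finset.sum_div]
  field_simp

/-- The unit inversion is an involution off the origin. [cite: BenedettiPetronio1992, A.3.5] -/
theorem inversionN_inversionN {p : Fin (n + 1) → ℝ} (hp : ∑ m, p m ^ 2 ≠ 0) :
    (fun q : Fin (n + 1) → ℝ => fun l => q l / ∑ m, q m ^ 2) (fun l => p l / ∑ m, p m ^ 2) = p := by
  funext l
  simp only
  rw [inversionN_normSq_apply hp]
  field_simp

/-- The unit inversion is injective on any subset of the open upper half-space. [folklore] -/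
theorem inversionN_injOn {σ : Set (Fin (n + 1) → ℝ)} (hpos : σ ⊆ {p | 0 < p (Fin.last n)}) :
    InjOn (fun p : Fin (n + 1) → ℝ => fun l => p l / ∑ m, p m ^ 2) σ := by
  intro p hp q hq hpq
  have hp' := (inversionN_normSq_pos (hpos hp)).ne'
  have hq' := (inversionN_normSq_pos (hpos hq)).ne'
  rw [← inversionN_inversionN hp', ← inversionN_inversionN hq']
  exact congrArg (fun x : Fin (n + 1) → ℝ => fun l => x l / ∑ m, x m ^ 2) hpq

/-- The squared norm `x ↦ Σ xₘ²` has Fréchet derivative `v ↦ Σ 2 pₘ vₘ` at `p`. [folklore] -/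
theorem inversionN_hasFDerivAt_normSq (p : Fin (n + 1) → ℝ) :
    HasFDerivAt (fun x : Fin (n + 1) → ℝ => ∑ m, x m ^ 2)
      (∑ m, ((2 : ℕ) • p m ^ (2 - 1)) • ContinuousLinearMap.proj (R := ℝ) (φ := fun _ : Fin (n + 1) => ℝ) m) p := by
  refine HasFDerivAt.fun_sum fun m _ => ?_
  exact (hasFDerivAt_apply (𝕜 := ℝ) m p).pow 2

/-- Evaluation of that derivative: `D(Σ xₘ²)(p) v = 2 Σ pₘ vₘ = 2 (p ⬝ᵥ v)`. [folklore] -/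
theorem inversionN_normSq_fderiv_apply (p v : Fin (n + 1) → ℝ) :
    (∑ m, ((2 : ℕ) • p m ^ (2 - 1)) • ContinuousLinearMap.proj (R := ℝ) (φ := fun _ : Fin (n + 1) => ℝ) m) v
      = 2 * (p ⬝ᵥ v) := by
  simp [dotProduct, Finset.mul_sum, mul_assoc]

/-- The matrix of the derivative of the unit inversion at `p ≠ 0`: `‖p‖⁻² (I − (2/‖p‖²) p pᵀ)`. [folklore] -/
theorem inversionN_det_matrix {p : Fin (n + 1) → ℝ} (hp : ∑ m, p m ^ 2 ≠ 0) :
    ((∑ m, p m ^ 2)⁻¹ • ((1 : Matrix (Fin (n + 1)) (Fin (n + 1)) ℝ) - (2 / ∑ m, p m ^ 2) • vecMulVec p p)).det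
      = -((∑ m, p m ^ 2) ^ (n + 1))⁻¹ := by
  set s : ℝ := ∑ m, p m ^ 2 with hs
  have hpp : p ⬝ᵥ p = s := by simp [dotProduct, hs, sq]
  have h1 : (1 : Matrix (Fin (n + 1)) (Fin (n + 1)) ℝ) - (2 / s) • vecMulVec p p
      = 1 + vecMulVec ((-(2 / s)) • p) p := by
    rw [smul_vecMulVec, neg_smul, sub_eq_add_neg]
  rw [det_smul, Fintype.card_fin, h1, vecMulVec_eq (Fin 1), det_one_add_replicateCol_mul_replicateRow,
    dotProduct_smul, hpp, smul_eq_mul, inv_pow]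
  have hpow : s ^ (n + 1) ≠ 0 := pow_ne_zero _ hp
  field_simp
  ring

/-- **The derivative of the unit inversion and its determinant.** At `p ≠ 0` the inversion has the Fréchet
derivative `L` of matrix `‖p‖⁻² (I − (2/‖p‖²) p pᵀ)`, and `det L = −‖p‖^{-2(n+1)}`.
[cite: BenedettiPetronio1992, A.3.5] -/
theorem inversionN_hasFDerivAt_det {p : Fin (n + 1) → ℝ} (hp : ∑ m, p m ^ 2 ≠ 0) :
    ∃ L : (Fin (n + 1) → ℝ) →L[ℝ] (Fin (n + 1) → ℝ),
      HasFDerivAt (fun x : Fin (n + 1) → ℝ => fun l => x l / ∑ m, x m ^ 2) L p ∧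
      L.det = -((∑ m, p m ^ 2) ^ (n + 1))⁻¹ := by
  set s : ℝ := ∑ m, p m ^ 2 with hs
  set M : Matrix (Fin (n + 1)) (Fin (n + 1)) ℝ :=
    s⁻¹ • ((1 : Matrix (Fin (n + 1)) (Fin (n + 1)) ℝ) - (2 / s) • vecMulVec p p) with hM
  refine ⟨LinearMap.toContinuousLinearMap (Matrix.toLin' M), ?_, ?_⟩
  · -- the inversion is `x ↦ (Σ xₘ²)⁻¹ • x`; product rule
    have hnf := inversionN_hasFDerivAt_normSq p
    have hinv := (hasDerivAt_inv hp).comp_hasFDerivAt p hnf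
    have hsm := hinv.smul (hasFDerivAt_id (𝕜 := ℝ) p)
    have hfun : (fun x : Fin (n + 1) → ℝ => fun l => x l / ∑ m, x m ^ 2)
        = (fun x : Fin (n + 1) → ℝ => (∑ m, x m ^ 2)⁻¹) • id := by
      funext x
      funext l
      simp [div_eq_inv_mul]
    rw [hfun]
    refine hsm.congr_fderiv ?_
    ext v i
    have hL : ((LinearMap.toContinuousLinearMap (Matrix.toLin' M)) v) i
        = s⁻¹ * (v i - 2 / s * (p ⬝ᵥ v) * p i) := by
      simp only [LinearMap.coe_toContinuousLinearMap', Matrix.toLin'_apply, hM, Matrix.smul_mulVec,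
        Matrix.sub_mulVec, Matrix.one_mulVec, vecMulVec_mulVec, Pi.smul_apply, Pi.sub_apply, smul_eq_mul,
        MulOpposite.smul_eq_mul_unop, MulOpposite.unop_op]
      ring
    rw [hL]
    simp only [_root_.add_apply, _root_.smul_apply, ContinuousLinearMap.id_apply,
      ContinuousLinearMap.smulRight_apply, id, Pi.add_apply, Pi.smul_apply, smul_eq_mul, Function.comp_apply,
      inversionN_normSq_fderiv_apply, ← hs]
    field_simp
    ring
  · rw [LinearMap.det_toContinuousLinearMap, LinearMap.det_toLin']
    exact inversionN_det_matrix hp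

/-- **Inversion move** (stub `stub_inversionMove` of line `odd-hyperbolic-ladder`, every dimension). The unit inversion
`J p = p / ‖p‖²` of the upper half-space `ℝⁿ × ℝ₊` carries any representation `r = [σ, t^{-(n+1)}]`, `σ ⊆ {t > 0}`, to
every representation `r'` with domain `J '' σ` and integrand `t^{-(n+1)}` there by ONE change-of-variables move of
Kontsevich–Zagier's calculus: `[r] − [r'] ∈ KZ.changeOfVariablesRel ⊆ KZ.relations` (`J` is `ℚ`-semialgebraic and
injective on `σ`, with derivative of determinant `−‖p‖^{-2(n+1)}`, and `t^{-(n+1)} = ((J p) last)^{-(n+1)} · ‖p‖^{-2(n+1)}`).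
[cite: BenedettiPetronio1992, A.3.5] -/
theorem stub_inversionMove : ∀ (n : ℕ), ∀ (r r' : Literature.NumberTheory.Transcendental.KZ.IntegralRep (n + 1)), r.domain ⊆ {p : Fin (n + 1) → ℝ | 0 < p (Fin.last n)} → Set.EqOn r.integrand (fun p : Fin (n + 1) → ℝ => 1 / p (Fin.last n) ^ (n + 1)) r.domain → r'.domain = (fun p : Fin (n + 1) → ℝ => fun l => p l / ∑ m, p m ^ 2) '' r.domain → Set.EqOn r'.integrand (fun p : Fin (n + 1) → ℝ => 1 / p (Fin.last n) ^ (n + 1)) r'.domain → Literature.NumberTheory.Transcendental.KZ.Equivalent r r' := by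
  intro n r r' hpos hint hdom hint'
  -- a derivative at every point off the origin (chosen arbitrarily at the origin)
  have hex : ∀ x : Fin (n + 1) → ℝ, ∃ L : (Fin (n + 1) → ℝ) →L[ℝ] (Fin (n + 1) → ℝ),
      ∑ m, x m ^ 2 ≠ 0 → HasFDerivAt (fun y : Fin (n + 1) → ℝ => fun l => y l / ∑ m, y m ^ 2) L x ∧
        L.det = -((∑ m, x m ^ 2) ^ (n + 1))⁻¹ := by
    intro x
    by_cases hx : ∑ m, x m ^ 2 = 0
    · exact ⟨0, fun h => (h hx).elim⟩
    · obtain ⟨L, hL, hdet⟩ := inversionN_hasFDerivAt_det hx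
      exact ⟨L, fun _ => ⟨hL, hdet⟩⟩
  choose J' hJ' using hex
  refine KZ.changeOfVariablesRel_subset_relations
    ⟨n + 1, r, r', (fun p : Fin (n + 1) → ℝ => fun l => p l / ∑ m, p m ^ 2), J',
      inversionN_isSemialgebraicMapOn r.isSemialgebraic_domain hpos,
      fun x hx => ((hJ' x (inversionN_normSq_pos (hpos hx)).ne').1).hasFDerivWithinAt,
      inversionN_injOn hpos, hdom, fun x hx => ?_, rfl⟩
  have hs : 0 < ∑ m, x m ^ 2 := inversionN_normSq_pos (hpos hx)
  have hxl : 0 < x (Fin.last n) := hpos hx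
  have hx' : (fun l => x l / ∑ m, x m ^ 2) ∈ r'.domain := hdom ▸ mem_image_of_mem _ hx
  rw [hint hx, hint' hx', (hJ' x hs.ne').2, abs_neg, abs_of_pos (inv_pos.mpr (pow_pos hs _))]
  simp only
  have hpow : (∑ m, x m ^ 2) ^ (n + 1) ≠ 0 := pow_ne_zero _ hs.ne'
  have hxpow : x (Fin.last n) ^ (n + 1) ≠ 0 := pow_ne_zero _ hxl.ne'
  field_simp
  rw [div_pow, div_mul_cancel₀ _ hpow]

end Summit.KontsevichZagierPeriods.HyperbolicBloch.OffTetraSectorKernel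

end
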